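import Summits.NavierStokesRegularity.NavierStokesRegularity.Theorems.ScenarioCensusRowF1RingTopZoom
import HarnessLib

/-!
# LINE 44 «ring-top» port, part 3/6: §4a the kills' toolbox — rotations / screws as continuous linear maps (LINES 41/42 BY NAME), orbit geometry and the divergence-free generators, the
# structure of tangency to circles / helices, the curl under rotations and screws (COVARIANCE), the DRIFT LEMMA, the PINS

Re-homed for the scenario census (typer seat ns-census-typer-1 g10; the cells F1rx / F1krx and the floors are members of row F1 «DECIDED IN KERNEL IN FILES» (LINE 44: ref ns-census-ref g16
PRE-CHECK ✓ §21.18, critic PASS, lead booking OF RECORD at census v1.133); this port makes them TREE-decided): VERBATIM PORT of ns-idea-3 LINE 44 «ring-top»,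
`pub/ideators/ns-idea-3/lines/ring-top/line-ring-top.lean` sha16 74d818dbb34ba3da (1774 l., lean check rc 0, 0 sorry), split for the 400-line rule into `ScenarioCensusRowF1RingTop`
(§1) → `…RingTopZoom` (§2–§3) → `…RingTopCovariance` (§4a) → `…RingTopKill` (§4b) → `…RingTopFloors` (§5) → `…RingTopRows` (§6–§7 + census KEYS).  Lean text VERBATIM in namespace
`…Theorems.ScenarioCensus.RingTop` (the line's `…Cruxes.ScenarioCensusRowF1.RingTopLine` re-homed); port edits: the frame restated VERBATIM by the line from LINES 34–42 (`topSet`,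
`HasTypeIConstant`, `snapLevel`, `exists_fast_at`, `sqrt_mul_sq_mul`, `continuous_slice'`, `rotLin`, `rotCLM`, `coe_rotCLM`, `analyticAt_transport`, `rotZ_smul_eZ'`, `zoom_units`,
`eventually_forall_not_of_not_frequently`, `le_of_units`) is taken BY NAME from the landed ports (the line's own STRENGTHENED compactness / socket / zoom package / `tendsto_eval` with gradients are new statements and kept; `row_of_floor` = `ScalingTop.row_of_floor` BY NAME); elementary lemmas the line restates are the tree's BY NAME (`rotZ_add_vec'` / `rotZ_add_smul_eZ'` = `ScrewBlowdown.…`,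
`rotZ_smul_vec'` = `rotZ_smul`, `rotZ_neg_rotZ'` / `rotZ_rotZ_neg'` = `RotationOrder.…`, `rotZ_zero_vec'` = `rotZ_apply_zero_vec`, `curl_const_smul'` = `curl_const_smul_field`, `continuous_rotZ`,
`centre_mem` = `IsTypeIAncientMild.comp_add_right`, `hasDerivAt_rotZ_rotGen'` = `AxisymEndLiouville.AbsorbingAxisSwirlExtinction.hasDerivAt_rotZ_rotGen`, `rotGen_add_smul_eZ'` =
`PeriodicSlab.rotGen_add_smul_eZ`, `inner_gradient_eq_fderiv` = `Wu2026Salvage.inner_gradient_right_eq`, `rotZ_single_two` = `UnthreadedRigidity.ProfileHorn.rotZ_single_two'` — cone-free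
modules imported); `tendstoLocallyUniformly_comp_of_tendsto`, `analyticAt_linIso`, `smul_coord` (twins of lemmas in route-cone modules) are not re-declared (inlined / replaced by
`PiLp.smul_apply, smul_eq_mul`); `@[conjecture]` on the residual `RingCollapse` (≡ `ScenarioCensus.Row_F1`, OPEN); one-line docstrings added where missing (gate lint).  Statements untouched.

No census VALUE is moved here (row F1 stays OPEN-WITH-LINE; the members become TREE-decided by name); NS regularity is NOT proved; `Row_F1` is untouched (zero
movement, `ringCollapse_iff_rowF1`); no summit statement is proved by this file. Lemmas that restate already-landed tree declarations are taken BY NAME (gate lint `dedup.landed`): `topSet` = `TwoTimeTop.topSet`, `HasTypeIConstant` = `OneLevelTop.HasTypeIConstant`, `snapLevel` = `SnapshotTop.snapLevel`, `exists_fast_at` = `SnapshotTop.exists_fast_at`, `sqrt_mul_sq_mul` = `SnapshotTop.sqrt_mul_sq_mul`, `centre_mem` = `IsTypeIAncientMild.comp_add_right`, `continuous_slice'` = `ScalingTop.continuous_slice'`, `rotZ_add_vec'` = `ScrewBlowdown.rotZ_add_vec`, `rotZ_smul_vec'` = `rotZ_smul`, `rotZ_add_smul_eZ'` = `ScrewBlowdown.rotZ_add_smul_eZ`,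 `rotLin` = `ScrewTop.rotLin`, `rotCLM` = `ScrewTop.rotCLM`, `analyticAt_transport` = `ScrewTop.analyticAt_transport`, `rotZ_smul_eZ'` = `ScrewTop.rotZ_smul_eZ'`, `hasDerivAt_rotZ_rotGen'` = `AxisymEndLiouville.AbsorbingAxisSwirlExtinction.hasDerivAt_rotZ_rotGen`, `rotGen_add_smul_eZ'` = `PeriodicSlab.rotGen_add_smul_eZ`, `inner_gradient_eq_fderiv` = `Wu2026Salvage.inner_gradient_right_eq`, `rotZ_single_two` = `UnthreadedRigidity.ProfileHorn.rotZ_single_two'`, `rotZ_neg_rotZ'` = `RotationOrder.rotZ_neg_rotZ`, `rotZ_rotZ_neg'` = `RotationOrder.rotZ_rotZ_neg`, `rotZ_zero_vec'` = `rotZ_apply_zero_vec`, `curl_const_smul'` = `curl_const_smul_field`, `zoom_units` = `NeedleTop.zoom_units`, `eventually_forall_not_of_not_frequently` = `EchoTop.eventually_forall_not_of_not_frequently`, `le_of_units` = `ScalingTop.le_of_units`, `row_of_floor` = `ScalingTop.row_of_floor`.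
-/

-- the summit and its single problem share the name `NavierStokesRegularity` (D-0017 nested layout)
set_option linter.dupNamespace false

noncomputable section

open MeasureTheory Set Function Filter TopologicalSpace Metric
open scoped Topology NNReal ENNReal InnerProductSpace RealInnerProductSpace

namespace Summit.NavierStokesRegularity.NavierStokesRegularity.Theorems.ScenarioCensus.RingTop

open Literature.Analysis Literature.Analysis.FluidPDE
open Summit.NavierStokesRegularity.NavierStokesRegularity.Theorems
open Summit.NavierStokesRegularity.NavierStokesRegularity.Theses
open Summit.NavierStokesRegularity.NavierStokesRegularity.Theorems.LocalHelicityTubeDoorFrobeniusProfileRigidityHelicalSlice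
open Summit.NavierStokesRegularity.NavierStokesRegularity.Theorems.NearExtremalTransiencePerFlow.FilamentSelection
open Summit.NavierStokesRegularity.NavierStokesRegularity.Theorems.LocalSineTubeDoorProfileAlignedWindowRigidityAncient

/-! ## §4 THE KILLS — «VORTEX LINES ON KILLING ORBITS ⇒ SYMMETRIC VORTICITY ⇒ (DRIFT LEMMA) SYMMETRIC VELOCITY UP TO A GALILEAN DRIFT
⇒ (POINT PIN) SYMMETRY», via `div curl = 0`, the ROTATION COVARIANCE of the curl and KNSS's harmonic Liouville theorem

`G(y) := L⁻¹W(−1, L y + b)` is the conjugated slice of the conjugated member (`isTypeIAncientMild_conj_affine`): analytic, divergence-free,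
bounded by `M`; `Ω := curl G` is analytic.
* (KR) RING top ⇒ `W ≡ 0`: continuation of `Ω₂ = 0`, `w₀Ω₀ + w₁Ω₁ = 0` (analyticity); `Ω = g • J`, `g ∈ C¹` (tree Hadamard lemma, LINE 43's
  `circular_structure`); `div Ω = div curl G = 0` (tree `divergence_curl_eq_zero_holds`) and `div J = 0` give `Dg[J·] ≡ 0`, so `g` — hence
  `Ω` — is AXISYMMETRIC (`isAxisymmetricScalar_of_fderiv_rotGen`, `isAxisymmetric_smul_rotGenL`); the DRIFT LEMMA `drift`: `G − R₋θ∘G∘R_θ`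
  is curl-free (covariance `curl_conj` + axisymmetry of `Ω`), divergence-free and bounded, hence CONSTANT by the tree's
  `eq_of_curl_eq_zero_of_isDivFree_of_bounded` — the velocity is axisymmetric UP TO A GALILEAN DRIFT `d(θ) = G(0) − R₋θG(0)`; the APEX PIN
  (`G(0)` axial, `isAxisymmetric_of_drift_apexPin`) kills the drift: `G` is axisymmetric (swirl allowed), and the tree's
  `eq_zero_of_conj_isAxisymmetric_oneSlice` ends it.  (Without the drift lemma the pin is useless and without the pin the drift is real:
  `G + d`, `d ⟂ e₂`, has the same vortex lines.)
* (KHR) HELICAL RING top of pitch `h ≠ 0` ⇒ `W ≡ 0`: `Ω = f • ξ_h`, `f = Ω₂/h`; `div Ω = 0`, `div ξ_h = 0` make `f` screw-invariant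
  (`screwInvariant_of_fderiv`), so `Ω ∘ S_θ = R_θ ∘ Ω`; the drift lemma along the screws gives the drift `d(θ) = G(0) − R₋θG(hθe₂)`; the
  AXIS PIN (`G = 0` on the axis segment `|s| < a`) kills it for `|hθ| < a` and the screw GROUP PROPERTY for all `θ`
  (`screwEquivariant_of_drift_axisPin`): `G ∘ S_θ = R_θ ∘ G`, and the tree's `eq_zero_of_helical_slice_anyAxis` ends it. -/

-- `centre_mem`: the line restates the tree's `IsTypeIAncientMild.comp_add_right`; taken BY NAME (gate lint dedup.landed).

-- `continuous_slice'`: the line restates the tree's `ScalingTop.continuous_slice'`; taken BY NAME (gate lint dedup.landed).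

/-! ### The rotation `R_θ` as a continuous linear map (LINE 41/42 verbatim helpers) -/

-- `rotZ_add_vec'`: the line restates the tree's `ScrewBlowdown.rotZ_add_vec`; taken BY NAME (gate lint dedup.landed).

-- `rotZ_smul_vec'`: the line restates the tree's `rotZ_smul`; taken BY NAME (gate lint dedup.landed).

-- `rotZ_add_smul_eZ'`: the line restates the tree's `ScrewBlowdown.rotZ_add_smul_eZ`; taken BY NAME (gate lint dedup.landed).

-- `rotLin`: the line restates the tree's `ScrewTop.rotLin`; taken BY NAME (gate lint dedup.landed).

-- `rotCLM`: the line restates the tree's `ScrewTop.rotCLM`; taken BY NAME (gate lint dedup.landed).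

-- `continuous_rotZ`: the line restates the tree's `Literature.Analysis.FluidPDE.continuous_rotZ` (in the import closure and opened); taken BY NAME (gate lint dedup.landed).

-- `analyticAt_linIso`: a statement-twin of the landed `PeepholeEchoDoorTwisted.analyticAt_linearIsometryEquiv` (route-cone module, NOT imported); not re-declared — unused once `analyticAt_transport` is LINE 41's BY NAME.

-- `rotZ_smul_eZ'`: the line restates the tree's `ScrewTop.rotZ_smul_eZ'`; taken BY NAME (gate lint dedup.landed).

-- `analyticAt_transport`: the line restates the tree's `ScrewTop.analyticAt_transport`; taken BY NAME (gate lint dedup.landed).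

/-! ### Orbit geometry: rotations and screws; the generators `J`, `ξ_h` are divergence-free (LINE 43 helpers) -/

-- `hasDerivAt_rotZ_rotGen'`: the line restates the tree's `AxisymEndLiouville.AbsorbingAxisSwirlExtinction.hasDerivAt_rotZ_rotGen`; taken BY NAME (gate lint dedup.landed).

/-- The screw orbit `θ ↦ R_θ y + hθ e₂` has velocity `J(R_θ y) + h e₂`. -/
theorem hasDerivAt_screw' (y : E3) (h θ : ℝ) :
    HasDerivAt (fun θ => rotZ θ y + (h * θ) • eZ) (rotGen (rotZ θ y) + h • eZ) θ := by
  have h1 := AxisymEndLiouville.AbsorbingAxisSwirlExtinction.hasDerivAt_rotZ_rotGen y θ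
  have h2 : HasDerivAt (fun θ : ℝ => (h * θ) • (eZ : E3)) ((h * 1) • eZ) θ :=
    ((hasDerivAt_id θ).const_mul h).smul_const eZ
  rw [mul_one] at h2
  exact h1.add h2

-- `rotGen_add_smul_eZ'`: the line restates the tree's `PeriodicSlab.rotGen_add_smul_eZ`; taken BY NAME (gate lint dedup.landed).

/-- A coordinate of an analytic field is analytic. -/
theorem analyticAt_coord {G : E3 → E3} {y : E3} (hG : AnalyticAt ℝ G y) (i : Fin 3) :
    AnalyticAt ℝ (fun w => G w i) y :=
  ((EuclideanSpace.proj i : E3 →L[ℝ] ℝ).analyticAt (G y)).comp hG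

/-- `div J = 0` (trace of a skew matrix). -/
theorem divergence_rotGen (x : E3) : VectorCalculus.divergence rotGen x = 0 := by
  rw [divergence_eq_sum_three, (hasFDerivAt_rotGen x).fderiv]
  simp [rotGenL_apply, rotGen]

/-- `div (J + h e₂) = 0`. -/
theorem divergence_screwGen (h : ℝ) (x : E3) : VectorCalculus.divergence (fun y : E3 => rotGen y + h • eZ) x = 0 := by
  have e : fderiv ℝ (fun y : E3 => rotGen y + h • eZ) x = fderiv ℝ rotGen x := fderiv_add_const _
  unfold VectorCalculus.divergence
  rw [e]
  exact divergence_rotGen x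

-- `inner_gradient_eq_fderiv`: the line restates the tree's `Wu2026Salvage.inner_gradient_right_eq`; taken BY NAME (gate lint dedup.landed).

/-- **Incompressibility transport along circles**: a `C¹` scalar `f` with `Df(x)[J x] = 0` everywhere is an axisymmetric scalar. -/
theorem isAxisymmetricScalar_of_fderiv_rotGen {f : E3 → ℝ} (hf : Differentiable ℝ f)
    (h0 : ∀ x : E3, fderiv ℝ f x (rotGen x) = 0) : IsAxisymmetricScalar f := by
  intro θ x
  have hd : ∀ t : ℝ, HasDerivAt (fun t => f (rotZ t x)) (0 : ℝ) t := by
    intro t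
    have hc := (hf (rotZ t x)).hasFDerivAt.comp_hasDerivAt t (AxisymEndLiouville.AbsorbingAxisSwirlExtinction.hasDerivAt_rotZ_rotGen x t)
    rwa [h0] at hc
  have hconst := is_const_of_deriv_eq_zero (f := fun t => f (rotZ t x)) (fun t => (hd t).differentiableAt)
    (fun t => (hd t).deriv) θ 0
  simpa [rotZ_zero] using hconst

/-- **Incompressibility transport along helices**: `Df(x)[J x + h e₂] = 0` everywhere ⇒ `f` is invariant under the screw motions
`S_θ y = R_θ y + hθ e₂`. -/
theorem screwInvariant_of_fderiv {f : E3 → ℝ} (hf : Differentiable ℝ f) {h : ℝ}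
    (h0 : ∀ x : E3, fderiv ℝ f x (rotGen x + h • eZ) = 0) (θ : ℝ) (y : E3) :
    f (rotZ θ y + (h * θ) • eZ) = f y := by
  have hd : ∀ t : ℝ, HasDerivAt (fun t => f (rotZ t y + (h * t) • eZ)) (0 : ℝ) t := by
    intro t
    have hc := (hf (rotZ t y + (h * t) • eZ)).hasFDerivAt.comp_hasDerivAt t (hasDerivAt_screw' y h t)
    have e : rotGen (rotZ t y) + h • eZ = rotGen (rotZ t y + (h * t) • eZ) + h • (eZ : E3) := by
      rw [PeriodicSlab.rotGen_add_smul_eZ]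
    rw [e, h0] at hc
    exact hc
  have hconst := is_const_of_deriv_eq_zero (f := fun t => f (rotZ t y + (h * t) • eZ)) (fun t => (hd t).differentiableAt)
    (fun t => (hd t).deriv) θ 0
  simpa [rotZ_zero] using hconst

/-! ### Structure of tangency to circles / helices (LINE 43's Hadamard forms; applied here to the VORTICITY) -/

/-- **CIRCULAR STRUCTURE.**  A `C¹` field with no axial and no radial component is `f • J` with `f ∈ C⁰`; if the field is `C²`, `f ∈ C¹`
(Hadamard quotient, tree `eq_hadamardQuotFst_smul_rotGen` BY NAME). -/
theorem circular_structure {G : E3 → E3} (hG : ContDiff ℝ 2 G) (h2 : ∀ y : E3, G y 2 = 0)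
    (hr : ∀ y : E3, y 0 * G y 0 + y 1 * G y 1 = 0) :
    ∃ f : E3 → ℝ, ContDiff ℝ 1 f ∧ ∀ y, G y = f y • rotGen y := by
  refine ⟨hadamardQuotFst (fun y => G y 1), ?_, ?_⟩
  · have h1 : ContDiff ℝ 2 (fun y : E3 => G y 1) := (EuclideanSpace.proj (1 : Fin 3) : E3 →L[ℝ] ℝ).contDiff.comp hG
    exact contDiff_hadamardQuotFst (n := 1) (by exact_mod_cast h1)
  · exact eq_hadamardQuotFst_smul_rotGen (hG.of_le (by norm_num)) h2 hr

/-- **CORKSCREW STRUCTURE.**  A field `G` with `h G₀ + y₁ G₂ = 0` and `h G₁ − y₀ G₂ = 0` (`h ≠ 0`) is `f • (J + h e₂)` with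
`f = G₂ / h`. -/
theorem corkscrew_structure {G : E3 → E3} {h : ℝ} (hh : h ≠ 0) (h0 : ∀ y : E3, h * G y 0 + y 1 * G y 2 = 0)
    (h1 : ∀ y : E3, h * G y 1 - y 0 * G y 2 = 0) (y : E3) :
    G y = (G y 2 / h) • (rotGen y + h • eZ) := by
  ext i
  fin_cases i
  · simp [rotGen, eZ]
    field_simp
    linarith [h0 y]
  · simp [rotGen, eZ]
    field_simp
    linarith [h1 y]
  · simp [rotGen, eZ]
    field_simp

/-! ### NEW (LINE 44): the curl under rotations and screws — COVARIANCE; the DRIFT LEMMA; the PINS -/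

/-- Auxiliary lemma of the line, stated and proved verbatim (`rotZ_single_zero`). -/
theorem rotZ_single_zero (θ : ℝ) : rotZ θ (EuclideanSpace.single 0 (1:ℝ)) =
    Real.cos θ • EuclideanSpace.single 0 (1:ℝ) + Real.sin θ • EuclideanSpace.single 1 (1:ℝ) := by
  ext i; fin_cases i <;> simp [rotZ_apply_zero, rotZ_apply_one, rotZ_apply_two]

/-- Auxiliary lemma of the line, stated and proved verbatim (`rotZ_single_one`). -/
theorem rotZ_single_one (θ : ℝ) : rotZ θ (EuclideanSpace.single 1 (1:ℝ)) =
    (-Real.sin θ) • EuclideanSpace.single 0 (1:ℝ) + Real.cos θ • EuclideanSpace.single 1 (1:ℝ) := by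
  ext i; fin_cases i <;> simp [rotZ_apply_zero, rotZ_apply_one, rotZ_apply_two]

-- `rotZ_single_two`: the line restates the tree's `UnthreadedRigidity.ProfileHorn.rotZ_single_two'`; taken BY NAME (gate lint dedup.landed).

/-- **ROTATION COVARIANCE OF THE CURL, at the level of Jacobians**: `curl (R₋θ ∘ D ∘ R_θ) = R₋θ (curl D)` (checked in coordinates;
`cos² + sin² = 1` in the axial component). -/
theorem curlCLM_conj_rot (θ : ℝ) (D : E3 →L[ℝ] E3) :
    curlCLM ((ScrewTop.rotCLM (-θ)).comp (D.comp (ScrewTop.rotCLM θ))) = rotZ (-θ) (curlCLM D) := by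
  have hc := Real.cos_sq_add_sin_sq θ
  ext i; fin_cases i
  · simp [curlCLM_apply, ScrewTop.coe_rotCLM, rotZ_single_zero, rotZ_single_one, UnthreadedRigidity.ProfileHorn.rotZ_single_two', map_add, map_smul,
      rotZ_apply_zero, rotZ_apply_one, rotZ_apply_two, Real.cos_neg, Real.sin_neg]; ring
  · simp [curlCLM_apply, ScrewTop.coe_rotCLM, rotZ_single_zero, rotZ_single_one, UnthreadedRigidity.ProfileHorn.rotZ_single_two', map_add, map_smul,
      rotZ_apply_zero, rotZ_apply_one, rotZ_apply_two, Real.cos_neg, Real.sin_neg]; ring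
  · simp [curlCLM_apply, ScrewTop.coe_rotCLM, rotZ_single_zero, rotZ_single_one, UnthreadedRigidity.ProfileHorn.rotZ_single_two', map_add, map_smul,
      rotZ_apply_zero, rotZ_apply_one, rotZ_apply_two, Real.cos_neg, Real.sin_neg]
    linear_combination ((D (EuclideanSpace.single 0 1)) 1 - (D (EuclideanSpace.single 1 1)) 0) * hc

-- `rotZ_neg_rotZ'`: the line restates the tree's `RotationOrder.rotZ_neg_rotZ`; taken BY NAME (gate lint dedup.landed).

-- `rotZ_rotZ_neg'`: the line restates the tree's `RotationOrder.rotZ_rotZ_neg`; taken BY NAME (gate lint dedup.landed).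

-- `rotZ_zero_vec'`: the line restates the tree's `rotZ_apply_zero_vec`; taken BY NAME (gate lint dedup.landed).

/-- Chain rule for the screw conjugate `y ↦ R₋θ G(R_θ y + c)`. -/
theorem hasFDerivAt_conj {G : E3 → E3} {θ : ℝ} {c y : E3} {D : E3 →L[ℝ] E3} (hG : HasFDerivAt G D (rotZ θ y + c)) :
    HasFDerivAt (fun y => rotZ (-θ) (G (rotZ θ y + c))) ((ScrewTop.rotCLM (-θ)).comp (D.comp (ScrewTop.rotCLM θ))) y := by
  have h1 : HasFDerivAt (fun x : E3 => ScrewTop.rotCLM θ x + c) (ScrewTop.rotCLM θ) y := (ScrewTop.rotCLM θ).hasFDerivAt.add_const c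
  have h2 : HasFDerivAt (G ∘ fun x : E3 => ScrewTop.rotCLM θ x + c) (D.comp (ScrewTop.rotCLM θ)) y := hG.comp y h1
  exact (ScrewTop.rotCLM (-θ)).hasFDerivAt.comp y h2

/-- **COVARIANCE OF THE CURL under rotations and screws**: `curl (R₋θ ∘ G ∘ S)(y) = R₋θ (curl G)(S y)`, `S y = R_θ y + c`. -/
theorem curl_conj {G : E3 → E3} (θ : ℝ) (c y : E3) (hG : DifferentiableAt ℝ G (rotZ θ y + c)) :
    curl (fun y => rotZ (-θ) (G (rotZ θ y + c))) y = rotZ (-θ) (curl G (rotZ θ y + c)) := by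
  rw [curl_eq_curlCLM, curl_eq_curlCLM, (hasFDerivAt_conj hG.hasFDerivAt).fderiv, curlCLM_conj_rot]

/-- `R_θ R₋θ = 1` as continuous linear maps. -/
theorem rotCLM_comp_neg (θ : ℝ) : (ScrewTop.rotCLM θ).comp (ScrewTop.rotCLM (-θ)) = ContinuousLinearMap.id ℝ E3 := by
  ext1 x
  simp [ScrewTop.coe_rotCLM, RotationOrder.rotZ_rotZ_neg]

/-- **Covariance of the divergence** under the same conjugation (trace of a conjugate). -/
theorem divergence_conj {G : E3 → E3} (θ : ℝ) (c y : E3) (hG : DifferentiableAt ℝ G (rotZ θ y + c)) :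
    VectorCalculus.divergence (fun y => rotZ (-θ) (G (rotZ θ y + c))) y = VectorCalculus.divergence G (rotZ θ y + c) := by
  unfold VectorCalculus.divergence
  rw [(hasFDerivAt_conj hG.hasFDerivAt).fderiv]
  set D : E3 →L[ℝ] E3 := fderiv ℝ G (rotZ θ y + c)
  have e1 : (((ScrewTop.rotCLM (-θ)).comp (D.comp (ScrewTop.rotCLM θ)) : E3 →L[ℝ] E3) : E3 →ₗ[ℝ] E3) =
      (ScrewTop.rotCLM (-θ) : E3 →ₗ[ℝ] E3).comp ((D : E3 →ₗ[ℝ] E3).comp (ScrewTop.rotCLM θ : E3 →ₗ[ℝ] E3)) := rfl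
  have e2 : (ScrewTop.rotCLM θ : E3 →ₗ[ℝ] E3).comp (ScrewTop.rotCLM (-θ) : E3 →ₗ[ℝ] E3) = LinearMap.id := by
    apply LinearMap.ext
    intro x
    simp [ScrewTop.coe_rotCLM, RotationOrder.rotZ_rotZ_neg]
  rw [e1, LinearMap.trace_comp_comm', LinearMap.comp_assoc, e2, LinearMap.comp_id]

/-- **THE DRIFT LEMMA.**  `G ∈ C²` divergence-free and bounded, whose CURL is covariant under the screw `S y = R_θ y + c`
(`curl G (S y) = R_θ curl G (y)`): then `G − R₋θ ∘ G ∘ S` is CONSTANT — it is curl-free, divergence-free and bounded, and the tree's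
`eq_of_curl_eq_zero_of_isDivFree_of_bounded` (KNSS harmonic Liouville) BY NAME makes it constant. -/
theorem drift {G : E3 → E3} (hG : ContDiff ℝ 2 G) (hdiv : VectorCalculus.IsDivFree G) {M : ℝ} (hM : ∀ y, ‖G y‖ ≤ M)
    (θ : ℝ) (c : E3) (hΩ : ∀ y, curl G (rotZ θ y + c) = rotZ θ (curl G y)) (y : E3) :
    G y - rotZ (-θ) (G (rotZ θ y + c)) = G 0 - rotZ (-θ) (G c) := by
  set H : E3 → E3 := fun y => rotZ (-θ) (G (rotZ θ y + c)) with hH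
  have hGd : Differentiable ℝ G := hG.differentiable (by norm_num)
  have hS : ContDiff ℝ 2 (fun x : E3 => ScrewTop.rotCLM θ x + c) := (ScrewTop.rotCLM θ).contDiff.add contDiff_const
  have hHc : ContDiff ℝ 2 H := (ScrewTop.rotCLM (-θ)).contDiff.comp (hG.comp hS)
  have hHd : Differentiable ℝ H := hHc.differentiable (by norm_num)
  have hV : ContDiff ℝ 2 (fun y => G y - H y) := hG.sub hHc
  have hcurl : ∀ y, curl (fun y => G y - H y) y = 0 := by
    intro y
    rw [curl_sub (hGd y) (hHd y), hH, curl_conj θ c y (hGd _), hΩ, RotationOrder.rotZ_neg_rotZ, sub_self]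
  have hdivV : VectorCalculus.IsDivFree (fun y => G y - H y) := by
    intro y
    have h1 : VectorCalculus.divergence (fun y => G y - H y) y =
        VectorCalculus.divergence G y - VectorCalculus.divergence H y := by
      unfold VectorCalculus.divergence
      rw [fderiv_fun_sub (hGd y) (hHd y), ContinuousLinearMap.toLinearMap_sub, map_sub]
    rw [h1, hdiv y, hH, divergence_conj θ c y (hGd _), hdiv, sub_self]
  have hbd : ∀ y, ‖G y - H y‖ ≤ M + M := fun y =>
    (norm_sub_le _ _).trans (add_le_add (hM y) (by simp only [hH, norm_rotZ]; exact hM _))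
  have := eq_of_curl_eq_zero_of_isDivFree_of_bounded hV hcurl hdivV hbd y 0
  simpa [hH, rotZ_apply_zero_vec] using this

/-- **THE APEX PIN.**  If `G − R₋θ ∘ G ∘ R_θ` is constant for every `θ` (the drift lemma's conclusion about a fixed apex) and the
velocity AT THE APEX is axial (`G(0)₀ = G(0)₁ = 0`), the constants vanish: `G` is axisymmetric (swirl allowed). -/
theorem isAxisymmetric_of_drift_apexPin {G : E3 → E3}
    (hdrift : ∀ (θ : ℝ) (y : E3), G y - rotZ (-θ) (G (rotZ θ y)) = G 0 - rotZ (-θ) (G 0))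
    (h0 : G 0 0 = 0) (h1 : G 0 1 = 0) : IsAxisymmetric G := by
  intro θ x
  have hG0 : G 0 = (G 0 2) • eZ := by
    ext i
    fin_cases i
    · simpa [eZ] using h0
    · simpa [eZ] using h1
    · simp [eZ]
  have hd : G 0 - rotZ (-θ) (G 0) = 0 := by
    rw [hG0, ScrewTop.rotZ_smul_eZ', sub_self]
  have e := hdrift θ x
  rw [hd, sub_eq_zero] at e
  rw [e, RotationOrder.rotZ_rotZ_neg]

/-- Composition of the screw motions of pitch `h`: `S_{θ₁+θ₂} = S_{θ₁} ∘ S_{θ₂}`. -/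
theorem screw_add' (h θ₁ θ₂ : ℝ) (y : E3) :
    rotZ (θ₁ + θ₂) y + (h * (θ₁ + θ₂)) • eZ = rotZ θ₁ (rotZ θ₂ y + (h * θ₂) • eZ) + (h * θ₁) • eZ := by
  rw [ScrewBlowdown.rotZ_add_smul_eZ, rotZ_add, mul_add, add_smul]
  abel

/-- **THE AXIS PIN.**  If `G − R₋θ ∘ G ∘ S_θ` (`S_θ y = R_θ y + hθ e₂`) is the constant `G(0) − R₋θ G(hθ e₂)` for every `θ` (the drift
/-- Auxiliary lemma of the line, stated and proved verbatim (`along`). -/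
lemma along the screws) and `G` VANISHES ON THE AXIS SEGMENT `{s e₂ : |s| < a}`, then the constants vanish for `|hθ| < a`, and the
GROUP PROPERTY of the screw motions (`S_{nφ} = S_φⁿ`) upgrades the small angles to all angles: `G ∘ S_θ = R_θ ∘ G` for every `θ`. -/
theorem screwEquivariant_of_drift_axisPin {G : E3 → E3} {h a : ℝ} (ha : 0 < a)
    (hdrift : ∀ (θ : ℝ) (y : E3),
      G y - rotZ (-θ) (G (rotZ θ y + (h * θ) • eZ)) = G 0 - rotZ (-θ) (G ((h * θ) • eZ)))
    (hax : ∀ s : ℝ, |s| < a → G (s • eZ) = 0) (θ : ℝ) (x : E3) :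
    G (rotZ θ x + (h * θ) • eZ) = rotZ θ (G x) := by
  -- small angles: the constants vanish
  have hG0 : G 0 = 0 := by simpa using hax 0 (by simpa using ha)
  have hsmall : ∀ φ : ℝ, |h * φ| < a → ∀ y : E3, G (rotZ φ y + (h * φ) • eZ) = rotZ φ (G y) := by
    intro φ hφ y
    have e := hdrift φ y
    rw [hG0, hax _ hφ, rotZ_apply_zero_vec, sub_zero, sub_eq_zero] at e
    rw [e, RotationOrder.rotZ_rotZ_neg]
  -- all angles: subdivide `θ = n · (θ / n)`
  obtain ⟨n, hn⟩ := exists_nat_gt (|h * θ| / a)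
  have hn0 : 0 < (n : ℝ) := lt_of_le_of_lt (div_nonneg (abs_nonneg _) ha.le) hn
  have hφ : |h * (θ / n)| < a := by
    rw [← mul_div_assoc, abs_div, abs_of_pos hn0, div_lt_iff₀ hn0]
    have h1 := (div_lt_iff₀ ha).1 hn
    linarith [h1]
  have key : ∀ (k : ℕ) (y : E3),
      G (rotZ ((k : ℝ) * (θ / n)) y + (h * ((k : ℝ) * (θ / n))) • eZ) = rotZ ((k : ℝ) * (θ / n)) (G y) := by
    intro k
    induction k with
    | zero =>
      intro y
      simp [rotZ_zero]
    | succ k ih =>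
      intro y
      rw [Nat.cast_succ, add_mul, one_mul, screw_add', ih, hsmall _ hφ, ← rotZ_add]
  have hθ : (n : ℝ) * (θ / n) = θ := by
    field_simp
  have hk := key n x
  rwa [hθ] at hk

end Summit.NavierStokesRegularity.NavierStokesRegularity.Theorems.ScenarioCensus.RingTop

end
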